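import Summits.CriticalPhenomena.PercolationContinuityZ3.Theorems.PercNearOneGluingNoHeavyQuantDIBStarBridge
import Summits.CriticalPhenomena.PercolationContinuityZ3.Theorems.PercNearOneGluingNoHeavyQuantIndepBlobExtraBlobs
import HarnessLib

/-!
# QUANT lane R8, FAR on general trees — Conjecture DIB\* REDUCED TO ITS CORNER: floor `> 1/2`, heavy sizes totalling `≤ 2j`,
# a non-empty light blob present (everything else is kernel: `dibStar_of_le_half`, `sizeRow_with_extra_blobs`, `far_indepBlob`)

builds on p205010 (kernel theorem, internal audit signed; external expert review pending)

Statement + support file (`--supports stmt-CriticalPhenomena-4575`), QUANT lane typer seat prim-quant-stmt (gen 17), rung R8 of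
`run/shared/lean/prim/quant/LADDER.md`; the gen-15 lead's closing ask (lane INBOX 06:30Z: "state the typed DIB\* so that
`dibStar_of_le_half` (`p₀ ≤ 1/2`) and `sizeRow_with_extra_blobs` (`p₀ ≥ 1/2`, `Σ_H a ≥ 2j+1`) discharge it by `exact`; the residual
conjecture is only the corner").  ONE `Prop` definition (the residual OPEN row, `@[conjecture]`), theorems otherwise; no sorries,
standard axioms.

* `Quant.IndepBlob.DIBStarCorner x` — Conjecture DIB\* (`Quant.IndepBlob.DIBStar x`, `…QuantDIBStar`) restricted to the instances with
  heavy sizes `Σ_{k : x ≤ g k} a k ≤ 2j` and at least one non-empty light blob (`g k < x`, `0 < a k`).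
* `Quant.IndepBlob.DIBStarCorner.of_dibStar` — trivially `DIBStar x → DIBStarCorner x`.
* `Quant.IndepBlob.DIBStar.of_corner` — **for `1/2 < x ≤ 1`: `DIBStarCorner x → DIBStar x`.**  The complement of the corner is
  kernel: heavy total `≥ 2j+1` ⟹ lead g15's `IndepBlob.sizeRow_with_extra_blobs` (`…QuantIndepBlobExtraBlobs`, p252105: the size row
  at odd total survives any finset of extra blobs of arbitrary gates — here the light ones; no credit used); no non-empty light blob
  ⟹ `Quant.IndepBlob.far_indepBlob_support` (through `Quant.RootDec.term_ge_of_budget`).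
* `Quant.IndepBlob.dibStar_iff_corner` — hence for `1/2 < x ≤ 1`, `DIBStar x ↔ DIBStarCorner x`; with `DIBStar.of_le_half`
  (`…QuantDIBStarBridge`) the STATUS of Conjecture DIB\* is: KERNEL on `(−∞, 1/2]`, and on `(1/2, 1]` EQUIVALENT TO THE CORNER.
  Evidence for the corner (lead g15 LEAD-NOTES-G15 N27/N29; census-2 g49 ARCH-TREES-G49 §7/§10): exact-clean (`4 616 / 0` on the
  den-8 grid, relative slack `≥ 0.25` off giants), but Cantelli/Markov alone certify only `96 % / 66 %` of it — a small-system /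
  closed-mass argument is the suggested route (README V192).

[this work]; the gluing rows served [cite: KozmaNitzan2024, Conjecture 3 (p. 15)].
-/

namespace Summit.CriticalPhenomena.PercolationContinuityZ3.Theorems

namespace Quant

namespace IndepBlob

open Finset

/-- **The corner of Conjecture DIB\* at floor `x`.**  Independent blobs with sizes `a : ι → ℕ` and gates `g : ι → [0,1]`, layer `j`;
light blobs (`g k < x`) of size `≤ j`; HEAVY SIZES TOTALLING AT MOST `2j` (`Σ_{k : x ≤ g k} a k ≤ 2j`); AT LEAST ONE NON-EMPTY LIGHT
BLOB; discounted credit `Σ_k a k·(g k | (g k − x²)/(1 − x)) > 2j`.  Then `x ≤ P(Σ_{k open} a k ≥ j+1)`.  For `1/2 < x ≤ 1` this is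
equivalent to `DIBStar x` (`dibStar_iff_corner`); it is the only part of DIB\* not in the kernel (README V192).  builds on p205010
(kernel theorem, internal audit signed; external expert review pending). [this work] [status: open] -/
@[conjecture] def DIBStarCorner (x : ℝ) : Prop :=
  ∀ (ι : Type) [Fintype ι] [DecidableEq ι] (a : ι → ℕ) (g : ι → ℝ) (j : ℕ),
    (∀ k, 0 ≤ g k ∧ g k ≤ 1) →
    (∀ k, g k < x → a k ≤ j) →
    (∑ k ∈ Finset.univ.filter (fun k => x ≤ g k), a k ≤ 2 * j) →
    (∃ k, g k < x ∧ 0 < a k) →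
    (2 * j : ℝ) < ∑ k, (a k : ℝ) * (if x ≤ g k then g k else (g k - x ^ 2) / (1 - x)) →
    x ≤ ∑ W : Finset ι, (∏ k, if k ∈ W then g k else 1 - g k) * (if j + 1 ≤ ∑ k ∈ W, a k then (1 : ℝ) else 0)

/-- The corner is a special case of DIB\*. [this work] -/
theorem DIBStarCorner.of_dibStar {x : ℝ} (h : DIBStar x) : DIBStarCorner x :=
  fun ι _ _ a g j hg hlight _ _ hcredit => h ι a g j hg hlight hcredit

/-- **DIB\* from its corner (`1/2 < x ≤ 1`).**  Off the corner the row is kernel: heavy total `≥ 2j+1` by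
`sizeRow_with_extra_blobs` (floor = least heavy gate `≥ x > 1/2`, the light blobs as extras), no non-empty light blob by
`far_indepBlob_support`. [this work] -/
theorem DIBStar.of_corner {x : ℝ} (hx : 1 / 2 < x) (hx1 : x ≤ 1) (h : DIBStarCorner x) : DIBStar x := by
  intro ι _ _ a g j hg hlight hcredit
  set L : Finset ι := Finset.univ.filter (fun k => g k < x) with hL
  have hmemL : ∀ k, k ∈ L ↔ g k < x := fun k => by simp [hL]
  by_cases hbig : 2 * j + 1 ≤ ∑ k ∈ Finset.univ.filter (fun k => x ≤ g k), a k
  · -- heavy total ≥ 2j+1: the odd-size row with the light blobs as extras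
    have hne : (Finset.univ.filter (fun k => x ≤ g k)).Nonempty := by
      rcases Finset.eq_empty_or_nonempty (Finset.univ.filter (fun k => x ≤ g k)) with h0 | h0
      · rw [h0, Finset.sum_empty] at hbig; omega
      · exact h0
    obtain ⟨y₀, hy₀, hy₀min⟩ := Finset.exists_min_image _ g hne
    have hxy₀ : x ≤ g y₀ := (Finset.mem_filter.1 hy₀).2
    have hy₀L : y₀ ∉ L := fun h' => (not_lt.2 hxy₀) ((hmemL y₀).1 h')
    have hcompl : ∀ k, k ∉ L → x ≤ g k := fun k hk => not_lt.1 fun h' => hk ((hmemL k).2 h')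
    have hsplit : ∑ k, a k = ∑ k ∈ L, a k + ∑ k ∈ Finset.univ.filter (fun k => x ≤ g k), a k := by
      rw [hL, ← Finset.sum_filter_add_sum_filter_not Finset.univ (fun k => g k < x) a]
      congr 1
      refine Finset.sum_congr ?_ fun _ _ => rfl
      ext k
      simp [not_lt]
    have hsize : 2 * j + 1 + ∑ k ∈ L, a k ≤ ∑ k, a k := by omega
    have row := sizeRow_with_extra_blobs g a (fun k => (hg k).1) (fun k => (hg k).2) L y₀ hy₀L
      (fun k hk => hy₀min k (Finset.mem_filter.2 ⟨Finset.mem_univ k, hcompl k hk⟩)) (by linarith) j hsize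
    rw [Finset.sum_filter] at row
    refine hxy₀.trans (row.trans (le_of_eq (Finset.sum_congr rfl fun W _ => ?_)))
    split_ifs <;> simp
  · by_cases hpres : ∃ k, g k < x ∧ 0 < a k
    · -- the corner proper
      exact h ι a g j hg hlight (by omega) hpres hcredit
    · -- no non-empty light blob: `far_indepBlob` (through `RootDec.term_ge_of_budget` with no sure part)
      have hzero : ∀ k, g k < x → a k = 0 := fun k hk => Nat.eq_zero_of_not_pos fun hpos => hpres ⟨k, hk, hpos⟩
      have hbudget : (2 * j : ℝ) < 2 * ((0 : ℕ) : ℝ) + ∑ k, (a k : ℝ) * g k := by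
        have hsum : ∑ k, (a k : ℝ) * (if x ≤ g k then g k else (g k - x ^ 2) / (1 - x)) = ∑ k, (a k : ℝ) * g k := by
          refine Finset.sum_congr rfl fun k _ => ?_
          by_cases hk : x ≤ g k
          · rw [if_pos hk]
          · rw [if_neg hk, hzero k (not_le.1 hk), Nat.cast_zero, zero_mul, zero_mul]
        rw [hsum] at hcredit
        rw [Nat.cast_zero, mul_zero, zero_add]
        exact hcredit
      have key := RootDec.term_ge_of_budget 0 a g j x hx1 hg (fun k hk => not_lt.1 fun h' => hk (hzero k h')) hbudget
      exact key.trans (le_of_eq (Finset.sum_congr rfl fun W _ => by rw [zero_add]))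

/-- **Status of Conjecture DIB\* above `1/2`**: for `1/2 < x ≤ 1`, `DIBStar x ↔ DIBStarCorner x`. [this work] -/
theorem dibStar_iff_corner {x : ℝ} (hx : 1 / 2 < x) (hx1 : x ≤ 1) : DIBStar x ↔ DIBStarCorner x :=
  ⟨DIBStarCorner.of_dibStar, DIBStar.of_corner hx hx1⟩

end IndepBlob

end Quant

end Summit.CriticalPhenomena.PercolationContinuityZ3.Theorems
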